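import Summits.BirchSwinnertonDyer.BirchSwinnertonDyer.Theses.LeadingTerm
import Summits.BirchSwinnertonDyer.BirchSwinnertonDyer.Theses.PAdicOrderV2
import Summits.BirchSwinnertonDyer.BirchSwinnertonDyer.Theses.SelmerRank
import Literature.NumberTheory.EllipticCurves.KatoRankBoundSelmerProofs
import HarnessLib

/-!
# BirchSwinnertonDyer / LeadingTerm — crux `Consistency` (stmt-BirchSwinnertonDyer-16217),
# line `Sketch`, stub S1b `stub_deficient_two_le_match`: conditional closures

Registered stub S1b of the skeleton `Cruxes/Consistency/Lines/Sketch.lean`: for `E/ℚ` (globally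
minimal `W`), a good ordinary prime `p ≥ 5`, the newform `f` of `E`, in the deficient cells
`2 ≤ r_MW < r_an` of MATCHED parity (`Even r_MW ↔ Even r_an`, so `r_an ≥ r_MW + 2`; first cell
`(2,4)`) the Taylor coefficient `[T^{r_MW}] L_p(E,T)` of `L_p(E,T) = padicLFunction f (unitRoot W p)`
vanishes.

This is OPEN mathematics: it needs `r_MW + 1 ≤ ord_T L_p(E,T)`, where Kato's bound
`r_MW ≤ ord_T L_p` (Astérisque 295, Thm 18.4) and parity `ord_T L_p ≡ r_an ≡ r_MW (mod 2)` do not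
help; it is implied by `p`-adic ORDER DOMINATION `r_an ≤ ord_T L_p`, the lower half of the sibling
crux `PAdicOrderComparisonR2` (stmt-BirchSwinnertonDyer-0489), open from `r_an = 4`
(`Literature.Barriers.BirchSwinnertonDyer.HeegnerPointBarrier`,
`PAdicFunctionalEquationSeesOnlyParity`). This file records, machine-checked, the two closures that
pin the stub to named items / facts, each stated ONCE for ALL deficient cells `1 ≤ r_MW < r_an`
(`deficient_coeff_eq_zero_of_…`) and then specialised verbatim to the registered S1b signature
(`stub_deficient_two_le_match_of_…`):

* (A) from the sibling crux `PAdicOrderComparisonR2` (`ord_T L_p = r_an`, Mazur–Tate–Teitelbaum's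
  `p`-adic BSD rank conjecture, Invent. Math. 84 (1986), §II.10): `r_MW < r_an = ord_T L_p`, so the
  `r_MW`-th coefficient vanishes (`PowerSeries.coeff_of_lt_order`);
* (B) from route SelmerRank's items `SelmerRankLB` (stmt-0131: `r_an ≤ corank Sel_{p^∞}` under
  surjective `ρ̄_{E,p}`, `p ≥ 5`) and `SelmerRankSmallImage` (stmt-14418: `corank Sel_{p^∞} = r_an`
  otherwise) — together the Selmer side `r_an ≤ corank_{ℤ_p} Sel_{p^∞}(E/ℚ)` at `p ≥ 5` — and the
  ∀-closure of Kato's divisibility (named fact `kato_divisibility`, Thm 17.4), through the tree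
  THEOREM `kato_selmerCorank_le_order_padicLFunction_of_kato_divisibility` (Thm 18.4:
  `corank Sel_{p^∞} ≤ ord_T L_p` at odd good ordinary `p`): `r_MW < r_an ≤ corank ≤ ord_T L_p`.

All statements are in colon form `hyp → … → <signature>` with fully qualified names, and are
registered as sub-goals of the crux (`ledger workitem stub-add`). The hypotheses `2 ≤ r_MW`
(resp. `1 ≤ r_MW`) and the parity match of the signatures are not used by the proofs; `5 ≤ p` is
used only in (B) (`p ≠ 2` for Kato, `5 ≤ p` for the SelmerRank items).
-/

set_option linter.dupNamespace false

namespace Summit.BirchSwinnertonDyer.BirchSwinnertonDyer.Theorems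

open scoped MatrixGroups ModularForm
open CongruenceSubgroup Literature.NumberTheory.EllipticCurves
  Literature.NumberTheory.EllipticCurves.ModularForms WeierstrassCurve

/-! ### (A) From the sibling crux `PAdicOrderComparisonR2` (stmt-0489) -/

/-- **All deficient cells from `p`-adic order comparison.** If `ord_{T=0} L_p(E,T) = r_an` at every
good ordinary `p` (the sibling crux `PAdicOrderComparisonR2`, stmt-BirchSwinnertonDyer-0489 =
clause (i) of the Mazur–Tate–Teitelbaum `p`-adic BSD conjecture), then in every deficient cell
`1 ≤ r_MW < r_an` the `r_MW`-th Taylor coefficient of `L_p(E,T)` vanishes: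
`r_MW < r_an = ord_T L_p` and `PowerSeries.coeff_of_lt_order`. Only the lower half
`r_an ≤ ord_T L_p` (order DOMINATION) is used. [cite: MazurTateTeitelbaum1986Invent, §II.10] -/
theorem deficient_coeff_eq_zero_of_comparison :
    Summit.BirchSwinnertonDyer.BirchSwinnertonDyer.Theses.PAdicOrderV2.PAdicOrderComparisonR2 →
    ∀ (W : WeierstrassCurve ℚ) [W.IsElliptic] [W.IsGloballyMinimal] (p : ℕ) [Fact p.Prime],
      5 ≤ p → Literature.NumberTheory.EllipticCurves.IsOrdinaryAt W p →
      ∀ {N : ℕ} [NeZero N] (f : CuspForm (CongruenceSubgroup.Gamma0 N) 2),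
        Literature.NumberTheory.EllipticCurves.ModularForms.IsNewformOf W f →
        1 ≤ W.mordellWeilRank → W.mordellWeilRank < W.analyticRank →
          PowerSeries.coeff W.mordellWeilRank
              (Literature.NumberTheory.EllipticCurves.padicLFunction f
                (Literature.NumberTheory.EllipticCurves.unitRoot W p : ℚ_[p])) = 0 := by
  intro hOC W _ _ p _ _ hord N _ f hf _ hlt
  refine PowerSeries.coeff_of_lt_order _ ?_
  rw [hOC W p hord f hf]
  exact_mod_cast hlt

/-- **Stub S1b from `p`-adic order comparison.** Colon form: the antecedent is the sibling crux
`PAdicOrderComparisonR2` (stmt-BirchSwinnertonDyer-0489, `ord_{T=0} L_p(E,T) = r_an` at every good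
ordinary `p`); the consequent is the registered stub `stub_deficient_two_le_match` of line `Sketch`
verbatim (names fully qualified). Proof: the matched-parity cells `2 ≤ r_MW < r_an` are deficient
cells, `deficient_coeff_eq_zero_of_comparison`. [cite: MazurTateTeitelbaum1986Invent, §II.10] -/
theorem stub_deficient_two_le_match_of_comparison :
    Summit.BirchSwinnertonDyer.BirchSwinnertonDyer.Theses.PAdicOrderV2.PAdicOrderComparisonR2 →
    ∀ (W : WeierstrassCurve ℚ) [W.IsElliptic] [W.IsGloballyMinimal] (p : ℕ) [Fact p.Prime],
      5 ≤ p → Literature.NumberTheory.EllipticCurves.IsOrdinaryAt W p →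
      ∀ {N : ℕ} [NeZero N] (f : CuspForm (CongruenceSubgroup.Gamma0 N) 2),
        Literature.NumberTheory.EllipticCurves.ModularForms.IsNewformOf W f →
        2 ≤ W.mordellWeilRank → W.mordellWeilRank < W.analyticRank →
          (Even W.mordellWeilRank ↔ Even W.analyticRank) →
          PowerSeries.coeff W.mordellWeilRank
              (Literature.NumberTheory.EllipticCurves.padicLFunction f
                (Literature.NumberTheory.EllipticCurves.unitRoot W p : ℚ_[p])) = 0 :=
  fun hOC W _ _ p _ h5 hord _ _ f hf h2 hlt _ =>
    deficient_coeff_eq_zero_of_comparison hOC W p h5 hord f hf (by omega) hlt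

/-! ### (B) From the Selmer side (route SelmerRank's items) and Kato's divisibility (Thm 17.4) -/

/-- **All deficient cells from the Selmer side and Kato's divisibility.** Antecedents: route
SelmerRank's items `SelmerRankLB` (stmt-BirchSwinnertonDyer-0131: `r_an ≤ corank_{ℤ_p} Sel_{p^∞}(E/ℚ)`
at good ordinary `p ≥ 5` with surjective `ρ̄_{E,p}`) and `SelmerRankSmallImage`
(stmt-BirchSwinnertonDyer-14418: `corank Sel_{p^∞} = r_an` at good ordinary `p ≥ 5` with
non-surjective `ρ̄_{E,p}`), and the ∀-closure of the named fact
`Literature.NumberTheory.EllipticCurves.kato_divisibility` (Kato, Astérisque 295, Thm 17.4) over its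
section variables `W, p, κ, γ, N, f`. Consequent: in every deficient cell `1 ≤ r_MW < r_an`, at
every good ordinary `p ≥ 5`, `[T^{r_MW}] L_p(E,T) = 0`. Proof: by cases on the surjectivity of
`ρ̄_{E,p}`, `r_an ≤ corank Sel_{p^∞}`; Kato's corank bound `corank Sel_{p^∞} ≤ ord_T L_p` (Thm 18.4)
is the tree theorem `kato_selmerCorank_le_order_padicLFunction_of_kato_divisibility` (`p ≠ 2` from
`5 ≤ p`; `IsOrdinaryAt W p` is good reduction `∧ p ∤ a_p`); so `r_MW < r_an ≤ ord_T L_p` in `ℕ∞` and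
`PowerSeries.coeff_of_lt_order` closes.
[cite: Kato2004Asterisque, Thm 17.4 (p. 273) and Thm 18.4 (p. 281)] -/
theorem deficient_coeff_eq_zero_of_selmerSide_of_kato_divisibility :
    Summit.BirchSwinnertonDyer.BirchSwinnertonDyer.Theses.SelmerRank.SelmerRankLB →
    Summit.BirchSwinnertonDyer.BirchSwinnertonDyer.Theses.SelmerRank.SelmerRankSmallImage →
    (∀ (W : WeierstrassCurve ℚ) [W.IsElliptic] [W.IsGloballyMinimal] (p : ℕ) [Fact p.Prime]
      (κ : Literature.NumberTheory.EllipticCurves.ZpExtension ℚ p) (γ : Field.absoluteGaloisGroup ℚ)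
      {N : ℕ} [NeZero N] (f : CuspForm (CongruenceSubgroup.Gamma0 N) 2),
      Literature.NumberTheory.EllipticCurves.kato_divisibility W p (κ := κ) (γ := γ) (f := f)) →
    ∀ (W : WeierstrassCurve ℚ) [W.IsElliptic] [W.IsGloballyMinimal] (p : ℕ) [Fact p.Prime],
      5 ≤ p → Literature.NumberTheory.EllipticCurves.IsOrdinaryAt W p →
      ∀ {N : ℕ} [NeZero N] (f : CuspForm (CongruenceSubgroup.Gamma0 N) 2),
        Literature.NumberTheory.EllipticCurves.ModularForms.IsNewformOf W f →
        1 ≤ W.mordellWeilRank → W.mordellWeilRank < W.analyticRank →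
          PowerSeries.coeff W.mordellWeilRank
              (Literature.NumberTheory.EllipticCurves.padicLFunction f
                (Literature.NumberTheory.EllipticCurves.unitRoot W p : ℚ_[p])) = 0 := by
  intro hLB hSI hkato W _ _ p _ h5 hord N _ f hf _ hlt
  -- the Selmer side at `p ≥ 5`: `r_an ≤ corank Sel_{p^∞}(E/ℚ)` (items, by cases on `ρ̄_{E,p}`)
  have hsel : W.analyticRank ≤ W.selmerCorank p := by
    by_cases hs : W.HasSurjectiveModNGaloisRep p
    · exact hLB W p h5 hord.1 hord.2 hs
    · exact (hSI W p h5 hord.1 hord.2 hs).ge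
  -- Kato Thm 18.4 (from Thm 17.4): `corank Sel_{p^∞}(E/ℚ) ≤ ord_T L_p` (in `ℕ∞`)
  have hK : (W.selmerCorank p : ℕ∞) ≤ (padicLFunction f (unitRoot W p : ℚ_[p])).order :=
    kato_selmerCorank_le_order_padicLFunction_of_kato_divisibility W p
      (fun κ γ ↦ hkato W p κ γ f) (by omega) hord hf
  refine PowerSeries.coeff_of_lt_order _ (lt_of_lt_of_le ?_ hK)
  exact_mod_cast lt_of_lt_of_le hlt hsel

/-- **Stub S1b from the Selmer side and Kato's divisibility.** Colon form: the antecedents are route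
SelmerRank's items `SelmerRankLB` (stmt-BirchSwinnertonDyer-0131) and `SelmerRankSmallImage`
(stmt-BirchSwinnertonDyer-14418) and the ∀-closure of the named fact `kato_divisibility` (Kato,
Astérisque 295, Thm 17.4; the same term as in `stub_deficient_two_le_mismatch_of_kato_divisibility`);
the consequent is the registered stub `stub_deficient_two_le_match` of line `Sketch` verbatim (names
fully qualified). Proof: the matched-parity cells `2 ≤ r_MW < r_an` are deficient cells,
`deficient_coeff_eq_zero_of_selmerSide_of_kato_divisibility`.
[cite: Kato2004Asterisque, Thm 17.4 (p. 273) and Thm 18.4 (p. 281)] -/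
theorem stub_deficient_two_le_match_of_selmerSide_of_kato_divisibility :
    Summit.BirchSwinnertonDyer.BirchSwinnertonDyer.Theses.SelmerRank.SelmerRankLB →
    Summit.BirchSwinnertonDyer.BirchSwinnertonDyer.Theses.SelmerRank.SelmerRankSmallImage →
    (∀ (W : WeierstrassCurve ℚ) [W.IsElliptic] [W.IsGloballyMinimal] (p : ℕ) [Fact p.Prime]
      (κ : Literature.NumberTheory.EllipticCurves.ZpExtension ℚ p) (γ : Field.absoluteGaloisGroup ℚ)
      {N : ℕ} [NeZero N] (f : CuspForm (CongruenceSubgroup.Gamma0 N) 2),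
      Literature.NumberTheory.EllipticCurves.kato_divisibility W p (κ := κ) (γ := γ) (f := f)) →
    ∀ (W : WeierstrassCurve ℚ) [W.IsElliptic] [W.IsGloballyMinimal] (p : ℕ) [Fact p.Prime],
      5 ≤ p → Literature.NumberTheory.EllipticCurves.IsOrdinaryAt W p →
      ∀ {N : ℕ} [NeZero N] (f : CuspForm (CongruenceSubgroup.Gamma0 N) 2),
        Literature.NumberTheory.EllipticCurves.ModularForms.IsNewformOf W f →
        2 ≤ W.mordellWeilRank → W.mordellWeilRank < W.analyticRank →
          (Even W.mordellWeilRank ↔ Even W.analyticRank) →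
          PowerSeries.coeff W.mordellWeilRank
              (Literature.NumberTheory.EllipticCurves.padicLFunction f
                (Literature.NumberTheory.EllipticCurves.unitRoot W p : ℚ_[p])) = 0 :=
  fun hLB hSI hkato W _ _ p _ h5 hord _ _ f hf h2 hlt _ =>
    deficient_coeff_eq_zero_of_selmerSide_of_kato_divisibility hLB hSI hkato W p h5 hord f hf
      (by omega) hlt

/-! ### (C) Through items only: SelmerRankLB, SelmerRankSmallImage, KatoCorankBound (route-choice rchoice-21073028) -/

/-- **All deficient cells through items only.** Antecedents: route SelmerRank's items `SelmerRankLB`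
(stmt-BirchSwinnertonDyer-0131: `r_an ≤ corank_{ℤ_p} Sel_{p^∞}(E/ℚ)` at good ordinary `p ≥ 5` with
surjective `ρ̄_{E,p}`) and `SelmerRankSmallImage` (stmt-BirchSwinnertonDyer-14418:
`corank Sel_{p^∞} = r_an` at good ordinary `p ≥ 5` with non-surjective `ρ̄_{E,p}`), and this route's
crux #5 `KatoCorankBound` (stmt-BirchSwinnertonDyer-18048: Kato's corank bound
`corank_{ℤ_p} Sel_{p^∞}(E/ℚ) ≤ ord_T L_p(E,T)` at odd good ordinary `p`, Astérisque 295, Thm 18.4 in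
corank form). Consequent: in every deficient cell `1 ≤ r_MW < r_an`, at every good ordinary `p ≥ 5`,
`[T^{r_MW}] L_p(E,T) = 0`. Proof: by cases on the surjectivity of `ρ̄_{E,p}`,
`r_MW < r_an ≤ corank Sel_{p^∞}` (items; `IsOrdinaryAt W p` is good reduction `∧ p ∤ a_p`), then
`corank Sel_{p^∞} ≤ ord_T L_p` (item `KatoCorankBound`, `p ≠ 2` from `5 ≤ p`), so
`r_MW < ord_T L_p` in `ℕ∞` and `PowerSeries.coeff_of_lt_order` closes. No named fact
`kato_divisibility` is used. [cite: Kato2004Asterisque, Thm 18.4 (p. 281)] -/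
theorem deficient_coeff_eq_zero_of_items :
    Summit.BirchSwinnertonDyer.BirchSwinnertonDyer.Theses.SelmerRank.SelmerRankLB →
    Summit.BirchSwinnertonDyer.BirchSwinnertonDyer.Theses.SelmerRank.SelmerRankSmallImage →
    Summit.BirchSwinnertonDyer.BirchSwinnertonDyer.Theses.LeadingTerm.KatoCorankBound →
    ∀ (W : WeierstrassCurve ℚ) [W.IsElliptic] [W.IsGloballyMinimal] (p : ℕ) [Fact p.Prime],
      5 ≤ p → Literature.NumberTheory.EllipticCurves.IsOrdinaryAt W p →
      ∀ {N : ℕ} [NeZero N] (f : CuspForm (CongruenceSubgroup.Gamma0 N) 2),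
        Literature.NumberTheory.EllipticCurves.ModularForms.IsNewformOf W f →
        1 ≤ W.mordellWeilRank → W.mordellWeilRank < W.analyticRank →
          PowerSeries.coeff W.mordellWeilRank
              (Literature.NumberTheory.EllipticCurves.padicLFunction f
                (Literature.NumberTheory.EllipticCurves.unitRoot W p : ℚ_[p])) = 0 := by
  intro hLB hSI hKC W _ _ p _ h5 hord N _ f hf _ hlt
  -- the Selmer side at `p ≥ 5`: `r_an ≤ corank Sel_{p^∞}(E/ℚ)` (items, by cases on `ρ̄_{E,p}`)
  have hsel : W.analyticRank ≤ W.selmerCorank p := by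
    by_cases hs : W.HasSurjectiveModNGaloisRep p
    · exact hLB W p h5 hord.1 hord.2 hs
    · exact (hSI W p h5 hord.1 hord.2 hs).ge
  -- item `KatoCorankBound` (Kato Thm 18.4, corank form): `corank Sel_{p^∞}(E/ℚ) ≤ ord_T L_p` in `ℕ∞`
  have hK : (W.selmerCorank p : ℕ∞) ≤ (padicLFunction f (unitRoot W p : ℚ_[p])).order :=
    hKC W p (by omega) hord f hf
  refine PowerSeries.coeff_of_lt_order _ (lt_of_lt_of_le ?_ hK)
  exact_mod_cast lt_of_lt_of_le hlt hsel

/-- **Stub S1b through items only.** Colon form: the antecedents are route SelmerRank's items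
`SelmerRankLB` (stmt-BirchSwinnertonDyer-0131) and `SelmerRankSmallImage`
(stmt-BirchSwinnertonDyer-14418) and this route's crux #5 `KatoCorankBound`
(stmt-BirchSwinnertonDyer-18048, Kato's corank bound, Astérisque 295, Thm 18.4); the consequent is
the registered stub `stub_deficient_two_le_match` of line `Sketch` verbatim (names fully qualified).
Proof: the matched-parity cells `2 ≤ r_MW < r_an` are deficient cells,
`deficient_coeff_eq_zero_of_items`. The line then names the fact `kato_divisibility` nowhere.
[cite: Kato2004Asterisque, Thm 18.4 (p. 281)] -/
theorem stub_deficient_two_le_match_of_items :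
    Summit.BirchSwinnertonDyer.BirchSwinnertonDyer.Theses.SelmerRank.SelmerRankLB →
    Summit.BirchSwinnertonDyer.BirchSwinnertonDyer.Theses.SelmerRank.SelmerRankSmallImage →
    Summit.BirchSwinnertonDyer.BirchSwinnertonDyer.Theses.LeadingTerm.KatoCorankBound →
    ∀ (W : WeierstrassCurve ℚ) [W.IsElliptic] [W.IsGloballyMinimal] (p : ℕ) [Fact p.Prime],
      5 ≤ p → Literature.NumberTheory.EllipticCurves.IsOrdinaryAt W p →
      ∀ {N : ℕ} [NeZero N] (f : CuspForm (CongruenceSubgroup.Gamma0 N) 2),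
        Literature.NumberTheory.EllipticCurves.ModularForms.IsNewformOf W f →
        2 ≤ W.mordellWeilRank → W.mordellWeilRank < W.analyticRank →
          (Even W.mordellWeilRank ↔ Even W.analyticRank) →
          PowerSeries.coeff W.mordellWeilRank
              (Literature.NumberTheory.EllipticCurves.padicLFunction f
                (Literature.NumberTheory.EllipticCurves.unitRoot W p : ℚ_[p])) = 0 :=
  fun hLB hSI hKC W _ _ p _ h5 hord _ _ f hf h2 hlt _ =>
    deficient_coeff_eq_zero_of_items hLB hSI hKC W p h5 hord f hf (by omega) hlt

end Summit.BirchSwinnertonDyer.BirchSwinnertonDyer.Theorems
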